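import Summits.HodgeConjecture.HodgeConjecture.Theorems.F0P6aModuliDatumLetters
import Summits.HodgeConjecture.HodgeConjecture.Theorems.F0P6aModuliDatumLayersApi
import HarnessLib

/-!
# `F0P6aModuliDatumLayers` — ★ RE-HOME of `Lines/F0_P6a_ModuliDatum.lean`, PART 2 of 3 (size-lint split; cut at a declaration boundary).

Imports (bare lines; provenance here): `Theorems.F0P6aModuliDatumLetters` = ★ the previous part of the same `Lines` workfile (size-lint split ×3) · `Theorems.F0P6aModuliDatumLayersApi` = ★ API
of the glue `pwcore_of_up_galq` (HEAD-ROOM CURE (γ) below) · `HarnessLib`.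
See PART 1 `Theorems/F0P6aModuliDatumLetters.lean` for the full re-home header and the original module docstring (verbatim there). Namespaces and sections KEPT
(re-opened below exactly as they stand at the cut, with their `open`∕`variable` lines replayed); code bytes = the workfile՚s, docstrings included (ONE exception: the PROOF of the glue,
next paragraph); options preamble repeated from PART 1.
HEAD-ROOM CURE (γ) (LEAD F0P6-plan «M-151a» (4); desk F0P6a-plan (g8), 2026-09-03): the PROOF of GLUE `pwcore_of_up_galq` — statement bytes IDENTICAL, budget
`set_option maxHeartbeats 400000 in` kept — is re-written as `Exists.elim` chains over the UP∕GALQ witnesses + ONE call of ★ API `pointwiseFrobeniusDatumAt_of_upstairs`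
(`Theorems/F0P6aModuliDatumLayersApi.lean`): 15 239 heartbeat-k-units measured (`#count_heartbeats`, `Elab.async false`) where the ED. 1 v2 proof paid 365 325 – 371 172 of 400 000
(LA2-p02 (g6) hb profile).  No other byte of this file moves; every head stays [propext, Classical.choice, Quot.sound].
HC_CM is proved only modulo the 7 printed citations (2 remaining: hLiu418 = stmt-HodgeConjecture-24832, h413 = stmt-HodgeConjecture-24833) until rung 0 closes; a re-home is count-neutral. -/

namespace Summit.HodgeConjecture.HodgeConjecture.Cruxes.HLiu418.F0P6aModuliDatum
set_option linter.dupNamespace false  -- `Summit.HodgeConjecture.HodgeConjecture.…` BY DESIGN (D-0017), as in `Lines/d6_cm_curve.lean`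
open CategoryTheory NumberField IsDedekindDomain MulAction
open scoped Matrix
open Literature.NumberTheory.GaloisRepresentations
open Literature.NumberTheory.Automorphic Literature.NumberTheory.Automorphic.UnitaryGroup
open Literature.AlgebraicGeometry.ShimuraVarieties.UnitaryCanonicalModel
open Literature.NumberTheory.Automorphic.Liu2021.AppendixC
open Literature.AlgebraicGeometry.Motives (AlgPoints IntegralModel frobeniusOver SchemeOver)
open Literature.NumberTheory.DiophantineGeometry (geomResidueField specialFibreFunctor)
open Literature.AlgebraicGeometry.RelativeSpec (ActionOver)
open Literature.NumberTheory.EllipticCurves (genericFibre)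
open Summit.HodgeConjecture.HodgeConjecture.Cruxes.HLiu418.F0P6aPointwiseFrobenius (FrobeniusDichotomy)
open Summit.HodgeConjecture.HodgeConjecture.Cruxes.HLiu418.F0D9opRoad2
  (PointwiseFrobeniusDatumAt RecordModuliPointwiseCoreCofinal)


/-! ### §2 LETTER GALQ — the tame Galois quotient descends the model and the level action -/

/-- **LETTER GALQ — `RecordGaloisQuotientDescent`** (ED. 1; the TAME GALOIS-QUOTIENT STEP, moduli-free, every input ★ — the twin of the LEAD՚s
MOD-QUOT `RecordTameLevelQuotientModel`, sharing its engine).  For a record datum, small levels `Kc ≤ K` with `Kc` normalised by `K`, the level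
group `G` (`φ : K ↠ G`, `ker φ = Kc`), an `F`-scheme `Y` over `M⋆_{Kc}` with an action `τ` of `Γ × G` (`Γ` finite of order invertible in
`𝒪_{F,(w)}`) such that `π : Y → M⋆_{Kc}` is a geometric quotient by `Γ` and `(1, φ k)` covers `T_{k⁻¹}`, and a smooth proper model `𝓨` of `Y`
over `𝒪_{F,(w)}` carrying an action `θ` of `Γ × G` with generic fibre `τ` and a stable affine cover: the TAME quotient `𝒮c := 𝓨 ∕ Γ` is a
smooth proper model of `M⋆_{Kc}` (★ `Motives.IntegralModel.exists_quotient_of_isProper` — SGA 1 V Prop. 1.9, Cor. 1.5, applied to the generic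
geometric quotient `π`; smooth of relative dimension one by ★ `ActionOver.smoothOfRelativeDimension_one_and_isProper_gluedDesc_of_isUnit_card`,
[KatzMazur1985] A7.1, residue fields of `Spec 𝒪_{F,(w)}` being perfect), the `G`-action DESCENDS along the quotient map to `ρ` on `𝒮c` over
`Spec 𝒪_{F,(w)}` (the `(1, g)` commute with `Γ × 1`; ★ `ActionOver.IsGeometricQuotient.desc` ∕ `ActionOver.gluedDesc`, the quotient being
categorical among separated schemes, [MumfordAV1970] §7 Thm. p. 66 (Remark)) with every point in a `ρ`-stable affine open (images of the
`θ`-stable ones: the quotient of an affine by a finite group is affine) and generic fibre `k ↦ T_{k⁻¹}` through `𝒮c.genericIso'` (uniqueness of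
descent along the epimorphism `π`), and the quotient map `πq : 𝓨 → 𝒮c` is `Γ`-INVARIANT (`θ(γ, 1) ≫ πq = πq` — ★ `IsGeometricQuotient.comp_eq`
of the quotient it is; v2, F0P6-ref1 o-5 repair F1) with generic fibre `π` through the two `genericIso'`.  The place `w` is arbitrary here (no
`hw` ∕ hyperspecial hypothesis is needed for the quotient; `_hJ`, `_hJu`, `_hKcK`, `_hφ`, `_hφker`, `_hcard`, `_hτT` are carried unused for
positional uniformity with UP — ref1 n9).  M–L; PROVABLE NOW from ★ (one small organ: the descent of a commuting action along `gluedMk` with its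
stable affine cover); dealt as a hand at ED. 1 (B-p18; lands `--supports stmt-HodgeConjecture-24832`, then `stub_GALQ := …_holds`).  NOT
asserted here.
(print: SGA1, Exp. V Prop. 1.8, Prop. 1.9, Cor. 1.5) (print: KatzMazur1985, A7.1) (print: MumfordAV1970, §7 Thm. p. 66) -/
def RecordGaloisQuotientDescent : Prop :=
  ∀ (F : Type) [Field F] [NumberField F] [IsCMField F] [IsGalois ℚ F] (ι₁ : F →+* ℂ)
    (Jstar : Matrix (Fin 2) (Fin 2) F)
    (K₀ : C5.OpenCompactSubgroup ↥(finAdelic ↥(maximalRealSubfield F) F (IsCMField.complexConj F) 2 Jstar))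
    (S : RecordSystemGS F Jstar ι₁ K₀) (hU7ₛ : S.HeckeTranslateDefinedOver)
    (_hJ : (Jstar.map (IsCMField.complexConj F))ᵀ = Jstar) (_hJu : IsUnit Jstar) (K : C5.SmallLevel K₀)
    (w : HeightOneSpectrum (𝓞 F))
    (Kc : C5.SmallLevel K₀) (_hKcK : Kc ≤ K) (hn : ∀ k ∈ K.1.1, C5.HeckeLE k Kc Kc)
    (G : Type) [Group G] [Finite G] (φ : ↥K.1.1 →* G) (_hφ : Function.Surjective φ)
    (_hφker : φ.ker = (Kc.1.1 : Subgroup ↥(finAdelic ↥(maximalRealSubfield F) F (IsCMField.complexConj F) 2 Jstar)).subgroupOf K.1.1)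
    (_hcard : IsUnit ((Nat.card G : ℕ) : HeightOneSpectrum.valuationSubringAtPrime F w))
    (Y : SchemeOver F) (π : Y ⟶ S.M.obj Kc)
    (Γ : Type) [Group Γ] [Finite Γ]
    (_hcardΓ : IsUnit ((Nat.card Γ : ℕ) : HeightOneSpectrum.valuationSubringAtPrime F w))
    (τ : ActionOver Y.hom (Γ × G))
    (_hτπ : (⟨τ.aut.comp (MonoidHom.inl Γ G), fun γ => τ.aut_comp (MonoidHom.inl Γ G γ)⟩ : ActionOver Y.hom Γ).IsGeometricQuotient
       π.left)
    (_hτT : ∀ k : ↥K.1.1,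
       (τ.aut (1, φ k)).hom ≫ π.left
         = π.left ≫
             (recordHeckeTranslateGS S hU7ₛ
               ((k : ↥(finAdelic ↥(maximalRealSubfield F) F (IsCMField.complexConj F) 2 Jstar))⁻¹) Kc Kc
               (hn _ (K.1.1.inv_mem k.2))).left)
    (𝓨 : IntegralModel (HeightOneSpectrum.valuationSubringAtPrime F w) F Y) (_h𝓨 : 𝓨.IsSmoothProper 1)
    (θ : ActionOver 𝓨.total.hom (Γ × G))
    (_hcovθ : ∀ y : ↥𝓨.total.left, ∃ O : θ.StableAffineOpens, y ∈ O.1)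
    (_hθ : ∀ a : Γ × G,
       (genericFibre (HeightOneSpectrum.valuationSubringAtPrime F w) F).map (Over.isoMk (θ.aut a) (θ.aut_comp a)).hom
           ≫ 𝓨.genericIso'.hom
         = 𝓨.genericIso'.hom ≫ (Over.isoMk (τ.aut a) (τ.aut_comp a)).hom),
    ∃ (𝒮c : IntegralModel (HeightOneSpectrum.valuationSubringAtPrime F w) F (S.M.obj Kc)) (_h𝒮c : 𝒮c.IsSmoothProper 1)
      (ρ : ActionOver 𝒮c.total.hom G)
      (_hcov : ∀ x : ↥𝒮c.total.left, ∃ O : ρ.StableAffineOpens, x ∈ O.1)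
      (_hρ : ∀ k : ↥K.1.1,
         (genericFibre (HeightOneSpectrum.valuationSubringAtPrime F w) F).map (Over.isoMk (ρ.aut (φ k)) (ρ.aut_comp (φ k))).hom
             ≫ 𝒮c.genericIso'.hom
           = 𝒮c.genericIso'.hom ≫
               recordHeckeTranslateGS S hU7ₛ
                 ((k : ↥(finAdelic ↥(maximalRealSubfield F) F (IsCMField.complexConj F) 2 Jstar))⁻¹) Kc Kc
                 (hn _ (K.1.1.inv_mem k.2)))
      (πq : 𝓨.total ⟶ 𝒮c.total) (_hπqΓ : ∀ γ : Γ, (θ.aut (γ, 1)).hom ≫ πq.left = πq.left),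
      (genericFibre (HeightOneSpectrum.valuationSubringAtPrime F w) F).map πq ≫ 𝒮c.genericIso'.hom = 𝓨.genericIso'.hom ≫ π

/-! ### §3 GLUE (proved), registered stubs, head -/

set_option maxHeartbeats 400000 in
/-- **GLUE `pwcore_of_up_galq` — PWCORE from UP and GALQ** (ED. 1 v2): `S₃ :=` UP՚s; at a split place `w ∉ S₃` UP gives
`(Kc, G, φ, Y, π, Γ, τ, 𝓨, θ, ℓ)` and the upstairs datum modulo `Γ`, GALQ gives `(𝒮c, ρ, πq)` with `πq` `Γ`-invariant; the READING
`mk := πq_s` (★ `specialFibreFunctor w` of `πq` on `κ̄(w)`-points), `Fr :=` the `N w`-Frobenius of `𝒮c ⊗ κ(w)`, is Frobenius-compatible by ★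
`AlgPoints.map_frobeniusOver_map` and `Γ`-invariant by `_hπqΓ` (functoriality of `specialFibreFunctor w`, ★ `AlgPoints.map_comp_apply`), so the
datum yields the dichotomy for the points `πq_s (red_𝓨 (ℓ Q))`, which are `red_{𝒮c} Q` by ★ `IntegralModel.geomReductionMap_map`
(`red_{𝒮c} (π P̃) = πq_s (red_𝓨 P̃)`, [SerreTate1968] §1) at `P̃ = ℓ Q`, `π (ℓ Q) = Q`.  HEAD-ROOM CURE (γ): the `∃`-plumbing is by `Exists.elim` (no `obtain` on the
27-binder witness) and the reading + transport is ★ API `pointwiseFrobeniusDatumAt_of_upstairs` BY NAME (15 239 heartbeats; was 365 325). [cite: SerreTate1968, §1]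
[cite: Hartshorne1977, IV Rem. 2.4.1] -/
theorem pwcore_of_up_galq :
    RecordModuliPointwiseCoreUpstairsCofinal → RecordGaloisQuotientDescent → RecordModuliPointwiseCoreCofinal := by
  refine fun hup hgal F _ _ _ _ ι₁ Jstar K₀ S hU7ₛ hJ hJu K => (hup F ι₁ Jstar K₀ S hU7ₛ hJ hJu K).elim fun S₃ hS =>
    ⟨S₃, hS.1, fun w hw₃ hw hunit hhyp => ?_⟩
  -- the 27 upstairs witnesses, opened by `Exists.elim` (no `cases` on the large goal)
  refine (hS.2 w hw₃ hw hunit hhyp).elim fun Kc h => h.elim fun hKcK h => h.elim fun hKc h => h.elim fun hn h =>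
    h.elim fun G h => h.elim fun _iG h => h.elim fun _iF h => h.elim fun φ h => h.elim fun hφ h => h.elim fun hφker h =>
    h.elim fun hcard h => h.elim fun Y h => h.elim fun π h => h.elim fun Γ h => h.elim fun _iΓ h => h.elim fun _iΓF h =>
    h.elim fun hcardΓ h => h.elim fun τ h => h.elim fun hτπ h => h.elim fun hτT h => h.elim fun 𝓨 h => h.elim fun h𝓨 h =>
    h.elim fun θ h => h.elim fun hcovθ h => h.elim fun hθ h => h.elim fun ℓ h => h.elim fun hℓ hγ => ?_
  -- the tame Galois quotient `(𝒮c, ρ, πq)` of GALQ, opened the same way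
  refine (hgal F ι₁ Jstar K₀ S hU7ₛ hJ hJu K w Kc hKcK hn G φ hφ hφker hcard Y π Γ hcardΓ τ hτπ hτT 𝓨 h𝓨 θ hcovθ hθ).elim
    fun 𝒮c h => h.elim fun h𝒮c h => h.elim fun ρ h => h.elim fun hcov h => h.elim fun hρ h => h.elim fun πq h =>
    h.elim fun hπqΓ hπq => ?_
  exact ⟨Kc, hKcK, hKc, hn, G, _iG, _iF, φ, hφ, hφker, hcard, 𝒮c, h𝒮c, ρ, hcov, hρ,
    pointwiseFrobeniusDatumAt_of_upstairs ι₁ Jstar K₀ S hU7ₛ hJ hJu w hw Kc π 𝓨 h𝓨 θ ℓ hℓ 𝒮c h𝒮c πq hπqΓ hπq hγ⟩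

/-! ### §4 (ED. 2) THE CUT OF `stub_UP` — GEO is ★ BY NAME; the one stub is the MODULI HEART `stub_MH`, typed THROUGH the isogeny dictionary

The upstairs letter UP asks, at a record datum and a small level `K`, for the 27 binders `(Kc, …, φ, …, _hcard, Y, π, Γ, …, _hcardΓ, τ, _hτπ, _hτT,
𝓨, h𝓨, θ, _hcovθ, _hθ, ℓ, _hℓ, datum)`.  ED. 2 sources them as follows (A-p18 (g27) census v2 7a1265c2 «=»; P6a census 8396c07d §2):
* `Kc, hKcK, hn, G, φ, hφ, hφker` and the GLOBAL model `𝓜` of `Y` (with its finite bad set `S_M`): the ∃-package of `stub_MH` (in print: the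
  level `Kc = K^w K₁(N)_w`, `G = K ∕ Kc`, and the restriction of scalars to `𝓞 F` of the RSZ ∕ Kottwitz fine moduli scheme over `𝒪_{Fᵢ}[1∕N]`);
* `Y := R_{Fᵢ} M⋆_{Kc}` (★ `thickening`), `π :=` ★ `thickeningπ`, `Γ := Fᵢ ≃ₐ[F] Fᵢ`, `τ :=` ★ `thickeningProdAction (S.M.obj Kc) σ` for the level action
  `σ : G → Aut_F(M⋆_{Kc})`, `σ (φ k) = T_{k⁻¹}` (★ `exists_levelQuotientAction_isGeometricQuotient`, re-homed in `Lines/F0_P6q_TameLevelQuotient`),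
  `_hτπ :=` ★ GAL-4 `isGeometricQuotient_inl_thickeningProdAction` (over ★ GAL-2 `isGeometricQuotient_thickeningπ`), `_hτT :=` ★
  `thickeningProdAction_inr_comp_π`, `ℓ := ℓ_e =` ★ `thickeningLift e` for a sheet `e : Fᵢ →ₐ[F] Ω` (Mathlib `IsAlgClosed.lift`), `_hℓ :=` ★
  `map_thickeningπ_thickeningLift`;
* cofinitely in `w` — `_hcard, _hcardΓ, h𝓨, θ, _hcovθ, _hθ` at `𝓨 := 𝓜.localise w`: ★ GEO-PKG `exists_integralPackage_eventually` (A-p18 (g27) p845032: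
  ★ GAL-5 smooth–proper–projective thickening, ★ SP-F `IntegralModel.eventually_isSmoothProper_localise`, ★ PROJ-SPREAD
  `IntegralModel.eventually_isProjective_localise` (A-p03 (g27) p844930), ★ `forall_exists_stableAffineOpen_over_of_isProjective` (B-p18 (g34)
  p844999), ★ `eventually_isUnit_natCard_valuationSubringAtPrime`) fed with ★ EQV-SPREAD `IntegralModel.eventually_exists_actionOver_localise`
  (A-p03 (g27) p844965 ∕ A-p01 (g23) p845041) — whose conclusion is GEO-PKG՚s hypothesis `hEQV` verbatim;
* the datum, in EVERY `Γ`-invariant Frobenius-compatible reading `(P, mk, Fr)` (v2, F0P6-ref1 o-5): from MH՚s ONE dictionary in the `Γ`-compatible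
  reading (β) — P6c՚s ★-written `PointDictionary` (F0P6c-plan (g0), DICT 81cfdcf7) towards the plain special points `P₀ = 𝓨_s(κ̄)` with the
  SHEET-CORRECTED Frobenius `Fr₀` and `red₀ = red_𝓨 ∘ ℓ_e` — by P6c՚s head `frobeniusDichotomy_of_pointDictionary` and the transport
  `frobeniusDichotomy_map` along `mk` (§4.1), using the named conjunct FROB-SHEET (`Fr₀ p = θ(γ, 1)_s (F̃ p)` for some `γ`) to see `mk ∘ Fr₀ = Fr ∘ mk`
  (F0P6-ref1 n20: ONE dictionary, not one per reading; LEAD M-4a ∕ M-9 (2)(c)).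
So the GEO half of UP is PAID BY NAME and `stub_UP := up_of_layers stub_MH` (§4.3); ED. 3 splits `stub_MH` = REP ∕ GEN ∕ HEART-fields ∕ FROB-SHEET. -/

section ED2

open Literature.AlgebraicGeometry.Motives (thickening thickeningπ thickeningGalAction thickeningLift thickeningProdAction
  map_thickeningπ_thickeningLift isGeometricQuotient_inl_thickeningProdAction thickeningProdAction_inr_comp_π thickeningProdAction_aut_comp_inl
  exists_integralPackage_eventually IsProjectiveOver)
open AlgebraicGeometry (QuasiCompact QuasiSeparated LocallyOfFinitePresentation Flat IsSeparated SmoothOfRelativeDimension)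
open Summit.HodgeConjecture.HodgeConjecture.Cruxes.HLiu418.F0P6cIsogenyDictionary (PointDictionary frobeniusDichotomy_of_pointDictionary)

/-! #### §4.1 Readings: the Frobenius sheet and the transport of the dichotomy -/

/-- **FROB-SHEET (the NAMED conjunct of MH that ED. 3 splits off).**  On a special point set `P₀` with the geometric Frobenius `frob` and an action
`act` of the Galois group `Γ` (the special fibre of `θ(γ, 1)`), a map `Fr₀ : P₀ → P₀` is a Γ-SHADOW OF FROBENIUS when every `Fr₀ p` is a
`Γ`-translate of `frob p`.  In print, on `𝓜_s(κ̄) = ⊔_ε (RSZ moduli) ⊗_ε κ̄`: the relative-Frobenius quotient `(A, ι, λ, η̄; ε) ↦ (A^{(q)}, …; ε)` keeps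
the sheet `ε` while the `q`-Frobenius `F̃` moves it to `Frob_q ∘ ε = ε ∘ γ̄_ε` (`γ_ε ∈ Γ` a Frobenius element at the place of `Fᵢ` cut out by `ε`,
inside the decomposition group since `Fᵢ ∕ F` is Galois and `w` is unramified) — so `Fr₀ = θ(γ_ε^{∓1}, 1)_s ∘ F̃` sheet by sheet.  Every `Γ`-INVARIANT
Frobenius-compatible reading `mk` then satisfies `mk ∘ Fr₀ = Fr ∘ mk`, which is all the transport below needs.
[cite: RapoportSmithlingZhang2020Diagonal, §3.2 and §4.1] [cite: Kottwitz1992, §5 pp. 389–391] [cite: GortzWedhorn2020, (14.20)] -/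
def FrobeniusSheet {P₀ Γ' : Type*} (frob : P₀ → P₀) (act : Γ' → P₀ → P₀) (Fr₀ : P₀ → P₀) : Prop :=
  ∀ p : P₀, ∃ γ : Γ', Fr₀ p = act γ (frob p)

/-- **Transport of the Frobenius dichotomy along a reading map.**  If `mk : P₀ → P` intertwines `Fr₀` and `Fr`, the dichotomy for
`(Fr₀; x̄, y, z)` gives the dichotomy for `(Fr; mk x̄, mk ∘ y, mk ∘ z)` (both branches are equations, pushed through `mk`). [folklore]
[cite: Liu2021, Prop. D.8 (3) p. 135] -/
theorem frobeniusDichotomy_map {P₀ P κ₁ κ₂ : Type*} (Fr₀ : P₀ → P₀) (Fr : P → P) (mk : P₀ → P)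
    (hmk : ∀ p, mk (Fr₀ p) = Fr (mk p)) {xbar : P₀} {y : κ₁ → P₀} {z : κ₂ → P₀} (h : FrobeniusDichotomy Fr₀ xbar y z) :
    FrobeniusDichotomy Fr (mk xbar) (fun β => mk (y β)) (fun β₂ => mk (z β₂)) := by
  rcases h with ⟨β₀, hβ₀, hrest⟩ | ⟨hall, hss⟩
  · exact Or.inl ⟨β₀, by beta_reduce; rw [hβ₀, hmk], fun β hβ β₂ => by beta_reduce; rw [← hmk, hrest β hβ β₂]⟩
  · exact Or.inr ⟨fun β => by beta_reduce; rw [hall β, hmk], fun β₂ => by beta_reduce; rw [← hmk, ← hmk, hss β₂]⟩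

/-! #### §4.2 LETTER MH — the moduli heart (XL; the ONE stub of ED. 2) -/

/-- **LETTER MH — `RecordModuliHeartCofinal`** (ED. 2; XL; owner F0-P6a; split at ED. 3 = REP ∕ GEN ∕ HEART-fields ∕ FROB-SHEET).  For every record
datum and small level `K` there are — ONE dependent ∃-package, nothing posited separately (D418, M-9 (2)(b)) —: a finite Galois extension `Fᵢ ∕ F`
(in print: containing the reflex ∕ moduli fields of the components of `M⋆`); the sublevel `Kc ≤ K` normalised by `K` (in print `K^w K₁(N)_w`,
`N` prime to `w` for the `w` in play); the finite group `G` with `φ : K ↠ G`, `ker φ = Kc`; a GLOBAL integral model `𝓜` over `𝓞 F` of the thickened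
curve `Y = R_{Fᵢ} M⋆_{Kc}` (★ `thickening`) whose total space is quasi-compact, quasi-separated, locally finitely presented, FLAT and SEPARATED over
`Spec 𝓞 F` (the binders of ★ EQV-SPREAD; in print: the RSZ ∕ Kottwitz fine moduli scheme over `𝒪_{Fᵢ}[1∕N]` for the `n = 2` CM datum with auxiliary
CM type, viewed over `𝓞 F` — smooth over `𝒪_{Fᵢ}[1∕N]`, hence flat, separated and finitely presented over `𝓞 F`; its generic fibre over `F` is
`(M⋆_{Kc} ⊗_F Fᵢ → Spec Fᵢ → Spec F) = R_{Fᵢ} M⋆_{Kc}` by the canonical model, [Liu2021] Rem. C.2 p. 108, Lemma C.18 p. 115, proof of Prop. C.20 p. 118,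
[Kottwitz1992] §8 p. 400, [Deligne1971TravauxShimura] 4.11, 4.15, Thm. 4.21, Cor. 5.5 — this is GEN; representability and quasi-projectivity «as on page 391 of
[Ko3] or §5.3 of [Car1]», [HarrisTaylorAMS2001] p. 110 l. 1–3 — this is REP); and a finite set
`S_M` of bad primes (`⊇` primes under `N·disc`, primes ramified in `Fᵢ`, degenerate primes of the auxiliary datum) — SUCH THAT at every split
`w ∉ S_M` with unit place form and `K` hyperspecial at `w|F⁺`: `Kc` is hyperspecial at `w|F⁺`, and FOR EVERY smooth-proper structure `h𝓨` on
`𝓨 := 𝓜 ⊗ 𝒪_{F,(w)}` (★ `IntegralModel.localise`), EVERY action `θ` of `Γ × G` (`Γ := Fᵢ ≃ₐ[F] Fᵢ`) on `𝓨` over `Spec 𝒪_{F,(w)}` whose `Γ`-PART has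
generic fibre the Galois action of the thickening (★ `thickeningGalAction`; the `G`-part is never looked at; such `θ(γ, 1)` are unique by schematic
density, so «every» costs nothing and lets GEO bring its own spread-out `θ`), and EVERY sheet `e : Fᵢ →ₐ[F] Ω` (`Ω = \overline{F_w}`): THERE IS a
map `Fr₀` on the plain special points `P₀ := 𝓨_s(κ̄(w))` which is (FROB-SHEET, the named conjunct `FrobeniusSheet`) a `Γ`-shadow of the geometric
Frobenius `F̃`, TOGETHER WITH an ISOGENY DICTIONARY (P6c՚s ★-written letter-structure `PointDictionary`, DICT 81cfdcf7; `Nonempty` of a `Type`-valued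
record) at the level `Kc` towards the reading `(P₀, Fr₀, red₀ := red_𝓨 ∘ ℓ_e)` (★ `IntegralModel.geomReductionMap`, ★ `thickeningLift`).  In print
(the HEART): `Ω`-points of `𝓜` ↔ CM tuples `(A, ι, λ, η̄)` on a sheet (GEN), reduction of points = reduction of tuples (REP over the test rings `Ω`,
`𝒪_{Ω}`-valuation ring, `κ̄`; Néron ∕ Serre–Tate), Hecke translates `T_{rc β}` = quotients by the lines of `𝒢_y[ϖ]` ([HarrisTaylorAMS2001] §III.4),
`Fr₀ :=` the quotient by the Frobenius kernel (same sheet), and the dictionary fields (c1)(c2)(c3a–c)(b)(b4′) from the P6b ∕ P6d organs — [Liu2021]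
Prop. D.8 and proof of Cor. D.9, [Carayol1986Compositio] §10.3, [Wedhorn2000CongruenceRelation].  WHY IT MIGHT FAIL (as typed): (i) fine
representability needs `N ≥ 3` and `w ∤ N`, absorbed by `Kc` and `S_M`; (ii) GEN needs ONE `Fᵢ` Galois over `F` over which all components and their
moduli interpretations are defined ([Liu2021] Rem. C.2 p. 108 l. 4602–4610, Lemma C.18 p. 115); (iii) `Fr₀` is ONE map on all sheets — fine, the shadow element `γ` may depend
on the point; (iv) quantifying over every `h𝓨`, `θ`, `e` is harmless (proof-irrelevant ∕ unique ∕ conjugate sheets).  NOT asserted; ONE honest `sorry`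
(`stub_MH`).  o-5-SAFE: no identity between special-fibre points of the thickened model is asserted except through `Fr₀`՚s `Γ`-shadow clause;
n20-SAFE: ONE dictionary in ONE reading.
(print: RapoportSmithlingZhang2020Diagonal, §4.1 Thm. 4.1 p. 17) (print: Kottwitz1992, §5 pp. 389–391, §8 p. 400) (print: Liu2021, Rem. C.2 p. 108, Lemma C.18 p. 115, proof of Prop. C.20 p. 118, Prop. D.8 p. 135, proof of Cor. D.9 p. 139)
(print: Deligne1971TravauxShimura, 4.11, 4.15, Thm. 4.21, Cor. 5.5, Ex. 5.8) (print: HarrisTaylorAMS2001, §III.4, pp. 108–110; p. 110 l. 1–3) (print: Carayol1986Compositio, §10.3, Prop. p. 211)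
(print: Wedhorn2000CongruenceRelation, main theorem (Introduction)) -/
def RecordModuliHeartCofinal : Prop :=
  ∀ (F : Type) [Field F] [NumberField F] [IsCMField F] [IsGalois ℚ F] (ι₁ : F →+* ℂ)
    (Jstar : Matrix (Fin 2) (Fin 2) F)
    (K₀ : C5.OpenCompactSubgroup ↥(finAdelic ↥(maximalRealSubfield F) F (IsCMField.complexConj F) 2 Jstar))
    (S : RecordSystemGS F Jstar ι₁ K₀) (hU7ₛ : S.HeckeTranslateDefinedOver)
    (hJ : (Jstar.map (IsCMField.complexConj F))ᵀ = Jstar) (hJu : IsUnit Jstar) (K : C5.SmallLevel K₀),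
    ∃ (Fi : Type) (_ : Field Fi) (_ : Algebra F Fi) (_ : FiniteDimensional F Fi) (_ : IsGalois F Fi)
      (Kc : C5.SmallLevel K₀) (_hKcK : Kc ≤ K) (_hn : ∀ k ∈ K.1.1, C5.HeckeLE k Kc Kc)
      (G : Type) (_ : Group G) (_ : Finite G) (φ : ↥K.1.1 →* G) (_hφ : Function.Surjective φ)
      (_hφker : φ.ker = (Kc.1.1 : Subgroup ↥(finAdelic ↥(maximalRealSubfield F) F (IsCMField.complexConj F) 2 Jstar)).subgroupOf K.1.1)
      (𝓜 : IntegralModel (𝓞 F) F ((thickening F Fi).obj (S.M.obj Kc)))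
      (_ : QuasiCompact 𝓜.total.hom) (_ : QuasiSeparated 𝓜.total.hom) (_ : LocallyOfFinitePresentation 𝓜.total.hom)
      (_ : Flat 𝓜.total.hom) (_ : IsSeparated 𝓜.total.hom)
      (S_M : Set (HeightOneSpectrum (𝓞 F))), S_M.Finite ∧
      ∀ w : HeightOneSpectrum (𝓞 F), w ∉ S_M → ∀ hw : (IsCMField.complexConj F) • w ≠ w,
        (UnitaryGroup.isUnit_placeForm Jstar hJu w).unit ∈ glInt 2 (w.adicCompletion F) →
          UnitaryGroup.IsHyperspecialAt ↥(maximalRealSubfield F) F (IsCMField.complexConj F) 2 Jstar K.1.1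
            (w.under (𝓞 ↥(maximalRealSubfield F))) →
          UnitaryGroup.IsHyperspecialAt ↥(maximalRealSubfield F) F (IsCMField.complexConj F) 2 Jstar Kc.1.1
              (w.under (𝓞 ↥(maximalRealSubfield F))) ∧
          ∀ (h𝓨 : (𝓜.localise w).IsSmoothProper 1)
            (θ : ActionOver (𝓜.localise w).total.hom ((Fi ≃ₐ[F] Fi) × G))
            (_hθ : ∀ γ : Fi ≃ₐ[F] Fi,
               (genericFibre (HeightOneSpectrum.valuationSubringAtPrime F w) F).map
                     (Over.isoMk (θ.aut (γ, 1)) (θ.aut_comp (γ, 1))).hom ≫ (𝓜.localise w).genericIso'.hom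
                 = (𝓜.localise w).genericIso'.hom ≫
                     (Over.isoMk ((thickeningGalAction (L := Fi) (S.M.obj Kc)).aut γ)
                       ((thickeningGalAction (L := Fi) (S.M.obj Kc)).aut_comp γ)).hom)
            (e : Fi →ₐ[F] AlgebraicClosure (w.adicCompletion F)),
            haveI : AlgebraicGeometry.IsProper (𝓜.localise w).total.hom := h𝓨.2
            ∃ Fr₀ : AlgPoints (𝓜.localise w).reductionAt (geomResidueField w) → AlgPoints (𝓜.localise w).reductionAt (geomResidueField w),
              FrobeniusSheet (fun p => AlgPoints.map (frobeniusOver (𝓜.localise w).reductionAt) p)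
                  (fun (γ : Fi ≃ₐ[F] Fi) p =>
                    AlgPoints.map ((specialFibreFunctor w).map (Over.isoMk (θ.aut (γ, 1)) (θ.aut_comp (γ, 1))).hom :
                      (𝓜.localise w).reductionAt ⟶ (𝓜.localise w).reductionAt) p)
                  Fr₀ ∧
                Nonempty (PointDictionary.{0, 0} F ι₁ Jstar K₀ S hU7ₛ hJ hJu w hw Kc
                  (AlgPoints (𝓜.localise w).reductionAt (geomResidueField w)) Fr₀
                  (fun y => (𝓜.localise w).geomReductionMap (thickeningLift e (S.M.obj Kc) y)))

/-! #### §4.3 ASSEMBLY `up_of_layers : MH → UP` (PROVED; GEO ★ by name) -/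

set_option maxHeartbeats 400000 in
/-- **ASSEMBLY `up_of_layers` — UP from the moduli heart MH, the GEO layer paid by ★ organs BY NAME** (ED. 2, PROVED, axioms = the Lean trio).
WITNESSES at a record datum and `K`: `(Fᵢ, Kc, G, φ, 𝓜, S_M)` from MH; `σ` = P6q՚s ★ `exists_levelQuotientAction_isGeometricQuotient`; `Y := R_{Fᵢ} M⋆_{Kc}`
(smooth projective: ★ `S.smooth` ∕ `S.projective`); `π :=` ★ `thickeningπ`; `Γ := Fᵢ ≃ₐ[F] Fᵢ`; `τ :=` ★ `thickeningProdAction (S.M.obj Kc) σ`; `_hτπ :=` ★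
`isGeometricQuotient_inl_thickeningProdAction`; `_hτT :=` ★ `thickeningProdAction_inr_comp_π` + `σ (φ k) = T_{k⁻¹}`; `S₃ := S_M ∪` the finite
exceptional set of ★ GEO-PKG `exists_integralPackage_eventually` fed with ★ EQV `IntegralModel.eventually_exists_actionOver_localise τ 𝓜`; at
`w ∉ S₃`: `_hcard, _hcardΓ, h𝓨, θ, _hcovθ, _hθ` from the package, `ℓ := ℓ_e` (★ `thickeningLift`, `e :=` Mathlib `IsAlgClosed.lift`), `_hℓ :=` ★
`map_thickeningπ_thickeningLift`, and the datum in every `Γ`-invariant Frobenius-compatible reading `(P, mk, Fr)` := `frobeniusDichotomy_map mk`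
(with `mk ∘ Fr₀ = Fr ∘ mk` from FROB-SHEET + `_hinv` + `_hFr`) of P6c՚s ★ `frobeniusDichotomy_of_pointDictionary 𝔡` for MH՚s dictionary `𝔡` in the
reading `(P₀, Fr₀, red_𝓨 ∘ ℓ_e)` — MH՚s `Γ`-clause being GEO-PKG՚s `_hθ` at `(γ, 1)` (★ `thickeningProdAction_aut_comp_inl`).
[cite: GortzWedhorn2020, §(4.8)–(4.9) and (14.20)] [cite: SGA1, Exp. V, Prop. 1.8] [cite: SerreTate1968, §1] [cite: Liu2021, Prop. D.8 (3) p. 135] -/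
theorem up_of_layers (hMH : RecordModuliHeartCofinal) : RecordModuliPointwiseCoreUpstairsCofinal := by
  intro F _ _ _ _ ι₁ Jstar K₀ S hU7ₛ hJ hJu K
  obtain ⟨Fi, _fFi, _aFi, _fdFi, _gFi, Kc, hKcK, hn, G, _gG, _fG, φ, hφ, hφker, 𝓜, _qc, _qs, _lfp, _fl, _sep, S_M, hS_M, hheart⟩ :=
    hMH F ι₁ Jstar K₀ S hU7ₛ hJ hJu K
  -- the thickened record curve `Y = R_{Fᵢ} M⋆_{Kc}` and its Galois group `Γ`
  let X : SchemeOver F := S.M.obj Kc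
  let Y : SchemeOver F := (thickening F Fi).obj X
  let Γ : Type := Fi ≃ₐ[F] Fi
  haveI : SmoothOfRelativeDimension 1 X.hom := S.smooth Kc
  have hXproj : IsProjectiveOver X := S.projective Kc
  -- the level action `σ : G → Aut_F(M⋆_{Kc})`, `σ (φ k) = T_{k⁻¹}` (P6q re-home of ★ `exists_levelQuotientAction_isGeometricQuotient`)
  obtain ⟨σ, hσT, -, -⟩ :=
    Literature.AlgebraicGeometry.ShimuraVarieties.UnitaryCanonicalModel.RecordSystemGS.exists_levelQuotientAction_isGeometricQuotient
      S hU7ₛ hJ hJu hKcK hn G φ hφ hφker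
  -- the product action `τ` of `Γ × G` on `Y` (★ GAL-4)
  let τ : ActionOver Y.hom (Γ × G) := thickeningProdAction (L := Fi) X σ
  -- cofinitely in `w`: EQV-SPREAD (★ A-p03 ∕ A-p01) feeds the integral package (★ GEO-PKG, A-p18)
  have hpkg := exists_integralPackage_eventually (Fi := Fi) 𝓜 hXproj σ
    (Literature.AlgebraicGeometry.Limits.IntegralModel.eventually_exists_actionOver_localise τ 𝓜)
  have hT := Filter.eventually_cofinite.mp hpkg
  refine ⟨S_M ∪ {w | ¬ _}, hS_M.union hT, fun w hw₃ hw hunit hhyp => ?_⟩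
  have hPw := by_contra fun h => hw₃ (Set.mem_union_right S_M h)
  obtain ⟨huG, huΓ, hsp, θ, hcov, hθ⟩ := hPw
  obtain ⟨hKc, hdat⟩ := hheart w (fun h => hw₃ (Set.mem_union_left _ h)) hw hunit hhyp
  -- a sheet `e : Fᵢ → Ω`
  let e : Fi →ₐ[F] AlgebraicClosure (w.adicCompletion F) := IsAlgClosed.lift
  -- the `Γ`-part of `θ` extends the Galois action of the thickening (GEO-PKG՚s `_hθ` at `(γ, 1)`, ★ `thickeningProdAction_aut_comp_inl`)
  have hτ1 : ∀ γ : Γ, τ.aut (γ, 1) = (thickeningGalAction (L := Fi) X).aut γ := fun γ =>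
    DFunLike.congr_fun (thickeningProdAction_aut_comp_inl (L := Fi) X σ) γ
  have hθΓ : ∀ γ : Γ,
      (genericFibre (HeightOneSpectrum.valuationSubringAtPrime F w) F).map (Over.isoMk (θ.aut (γ, 1)) (θ.aut_comp (γ, 1))).hom
          ≫ (𝓜.localise w).genericIso'.hom
        = (𝓜.localise w).genericIso'.hom ≫
            (Over.isoMk ((thickeningGalAction (L := Fi) X).aut γ) ((thickeningGalAction (L := Fi) X).aut_comp γ)).hom := by
    intro γ
    have h2 : (Over.isoMk (τ.aut (γ, 1)) (τ.aut_comp (γ, 1))).hom =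
        (Over.isoMk ((thickeningGalAction (L := Fi) X).aut γ) ((thickeningGalAction (L := Fi) X).aut_comp γ)).hom :=
      Over.OverMorphism.ext (by change (τ.aut (γ, 1)).hom = ((thickeningGalAction (L := Fi) X).aut γ).hom; rw [hτ1])
    rw [← h2]
    exact hθ (γ, 1)
  -- MH at `w`: the Frobenius sheet and the dictionary in the reading `(P₀, Fr₀, red_𝓨 ∘ ℓ_e)`
  obtain ⟨Fr₀, hsheet, ⟨𝔡⟩⟩ := hdat hsp θ hθΓ e
  refine ⟨Kc, hKcK, hKc, hn, G, _gG, _fG, φ, hφ, hφker, huG, Y, thickeningπ (L := Fi) X, Γ, inferInstance, inferInstance, huΓ, τ,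
    isGeometricQuotient_inl_thickeningProdAction (L := Fi) X σ, ?_, 𝓜.localise w, hsp, θ, hcov, hθ, thickeningLift e X,
    fun P => map_thickeningπ_thickeningLift e X P, ?_⟩
  · -- `(1, φ k)` covers `T_{k⁻¹}` through `π`
    intro k
    rw [← hσT k]
    exact thickeningProdAction_inr_comp_π (L := Fi) X σ (φ k)
  · -- the datum in every `Γ`-invariant Frobenius-compatible reading, transported from the dictionary՚s reading
    intro P mk Fr hFr hinv N' hN'Kc rc₁ hrc₁ hrcN₁ rc₂ hrc₂ hrcN₂ x'
    have hmk : ∀ p, mk (Fr₀ p) = Fr (mk p) := fun p => by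
      obtain ⟨γ, hγ⟩ := hsheet p
      rw [hγ, hinv γ, hFr]
    exact frobeniusDichotomy_map Fr₀ Fr mk hmk
      (frobeniusDichotomy_of_pointDictionary F ι₁ Jstar K₀ S hU7ₛ hJ hJu w hw Kc _ _ _ 𝔡 N' hN'Kc rc₁ hrc₁ hrcN₁ rc₂ hrc₂ hrcN₂ x')

end ED2

end Summit.HodgeConjecture.HodgeConjecture.Cruxes.HLiu418.F0P6aModuliDatum
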